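import Literature.MathematicalPhysics.QuantumFieldTheory.Balaban1983to89.B9Eq3126H1BlockDecayTowerClosed
import Literature.MathematicalPhysics.QuantumFieldTheory.Balaban1983to89.B9Eq3126ClosingRadiusWindowTower

/-!
# `Balaban1983to89.B9Eq3126H1BlockDecayTowerClosedRadius` — T. Bałaban, *Propagators for lattice gauge theories in a background field*, Commun. Math. Phys.
# **99** (1985) 389–434 [Balaban1985BackgroundPropagators] (3.126) p. 420, (3.26) p. 395, (3.15)–(3.19) p. 393, (3.49) p. 399 («the constants … independent of
# the field configuration»), (3.79) p. 406, Thm 3.11 p. 416 with [Balaban1985Variational] (45)–(46) p. 285 («B₀ … uniform»), (103) p. 293: **THE `L²` BLOCK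
# DECAY OF `H₁,k(U) = G₁,k Q_k†(Q_kG₁,kQ_k†)⁻¹` AT EVERY HEIGHT WITH THE RATE CHOSEN ONCE — `∃ r₀ > 0` IN CLOSED FORM (free of the height `n`, the
# lattice `m`, the spacing `η`, the weights and the background) BEFORE `∀ n η c₀ c₁ m U`** — the OWNER's (H1TC)
# `B9Eq3126H1BlockDecayTowerClosed.norm_block_H1k_le_closed` (every conjugation ∕ size ∕ far-field letter discharged at `Q_k(U) := QkW`) at the closing radius
# of `B9Eq3126ClosingRadiusWindowTower` (`ℓ = ℓ′ = 1`, `β := N_βr₀`, `β′ := N′r₀`, `β_K := 8p_K⁰r₀`, `ρ := (6X + 9X)∕√κ₁`, `r′ := r₀∕2`; the tower `dQ` window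
# linearised height-free on print's diagonal), given ONLY the letters `γ` + `hpos` (Thm 3.11 for `Δ_{a,k}`), `μ₁` ([B11] (45); closed supplier
# `B9Eq3126QG1QLowerDiagonalClosed`), the `G′_k` side (`γ′`, `a′`, `hpos′`, `κ₁`, `M`), a bound `p_K⁰` of the curvature letter, and the MODEL letters
# with the geometric bond-window profile — the `∃`-first tower twin of `B9Eq3126H1BlockDecayUniformRadiusTower` with its letter binders `_hQK` ∕ `_hP` ∕
# `_hQ` ∕ `_hQa` ∕ `_hKre` DISCHARGED

statement-level skeleton of published theorems with citation tags; proofs where landed; nothing here is a claim about the Yang–Mills mass gap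

CITATION HEADER (lean-in-tree rule).  Audit cell `pub-balaban`, sub-cell `t4`, BINDER row NE9 (road ΔA-CT of the NE9 formalisation swarm, leaf prover 03
`b2b-balaban-t4-ne9-formalise-leaf-03` gen 77).  Imports BY NAME: the OWNER t4-ne9-p1 g94's (H1TC) `B9Eq3126H1BlockDecayTowerClosed` (`norm_block_H1k_le_closed`;
through it (HQKT), (TQ), (TR), (QC), this lineage's (H1DT) ∕ (GBT2) ∕ (PDCT), ne9-leaf-01's (N51)) and this lineage's `B9Eq3126ClosingRadiusWindowTower`
(`radiusT0_pos`, `le_ratios_of_le_radiusT0`, `eta_windows`, `unit_windows`, `slopes_le`, `small_window`, `small2_window`, `tower_dQ_diff_le_linear`).  Sources READ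
first-hand: [Balaban1985BackgroundPropagators] (`paper:balaban1985-cmp99-background-propagators`, journal page = PDF page + 388) pp. 393, 395, 399, 406, 416, 420;
[Balaban1985Variational] pp. 285, 293.  Print's decay of `H` is the random walk of Sect. C with «O(1)» constants; the cell's road is Combes–Thomas with every
window explicit; `r₀` below is the cell's closed form, NOT a value of print's `δ₀`.

WHAT IS PROVED (sorry-free; proof lane — no `def`; [folklore] composition BY NAME + the arithmetic of `B9Eq3126ClosingRadiusWindowTower`).
* **`exists_rate_block_decay_H1k_closed`** — for the letters `(d, L ≥ 2, M_φ, M_φ′, M_τ, a, a′, ε_s, ϱ < 1, γ′ ≤ 1, κ₁, M, γ ≤ 1, μ₁, p_K⁰ < γ∕2)`: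
  `∃ r₀`, `r₀ = ` the closed radius of `B9Eq3126ClosingRadiusWindowTower`, `0 < r₀`, and FOR EVERY height `n`, spacing `η` (`ηL^{n+1} = 1`), weights on the
  diagonal `c₀(L^{n+1})^d = c₁`, lattice `m`, background `U` of the MODEL letters (unit ball, `hRS`, per-level regime `50(d+1)α_jL^d ≤ ½`, geometric profile
  `ε_j ≤ ε_sϱ^j`, plaquette letters `δ` with the curvature letter `768·|DirPair d|·M_τM_φ²(‖η^d‖∕c₀)‖η⁻¹‖²δ ≤ p_K⁰`), the `G′_k`-side letters (`hpos′`,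
  `γ′`-coercivity, `κ₁`, `M`), ANY positivity witness `hpos` of `Δ_{a,k}(U)` with `γ`-coercivity and the `hX1` floor `μ₁`:
  `‖P_{y₁} ∘ H₁,k(U) ∘ r_{y₀}‖ ≤ (4∕γ)e^{r₀}·(C_Qe^{r₀})·(2∕μ₁)e^{r₀}·K_d(r₀∕2)²·e^{−(r₀∕2)·d_m(y₀,y₁)}`, `C_Q = M_φ′M_φ·exp(√(L^d)√(2d)·102(d+1)²L·ε_s∕(1−ϱ))`.
HONEST SCOPE.  Composition; the letters `γ` + `hpos`, `μ₁`, `γ′`, `a′`, `hpos′`, `κ₁`, `M`, `p_K⁰` and the MODEL letters are INPUTS (closed suppliers on the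
diagonal: the OWNER's `exists_coercive_laplaceAk_diagonal_closed`, this lineage's `B9Eq3126QG1QLowerDiagonalClosed`, the KAPPA1 ∕ Thm 3.11-scalar files — their
assembly is the sequel); crude constants; NOT print's `δ₀`, NOT a kernel (pointwise) bound; NOT NE9 (cell pub-balaban: NE9 NOT PRINTED ∕ NOT PROVED; «NE9 ⇐ the
named binders»; row WALLED ON A MODEL (O-NE9-1; #5 UNRULED); spine PROVED 0∕9; rung (B)+1 on a finite T⁴ — NOT infinite volume, NOT mass gap, NOT BetaPertH, NOT Clay;
HONEST DEPENDENCY: continuum YM on T⁴ ⇐ BetaPertH ∧ nine spine estimates (0/9 proved); BetaPertH ⇐ (D1) ∧ (D4) ∧ CAP+tail; G-an2-4 gates asym, D1 and NE2/3/4).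
NEW file; nothing modified.  Net new unproved facts: 0.
-/

noncomputable section

set_option autoImplicit false

open scoped InnerProductSpace ComplexConjugate BigOperators
open NormedSpace

namespace Literature.MathematicalPhysics.QuantumFieldTheory.Balaban1983to89.B9Eq3126H1BlockDecayTowerClosedRadius

open B4Sect5Torus (TSite tdist)
open B4Sect5Proof (latticeConst)
open B9SectCLatticeCarrier (Bond DirPair bpos btgt)
open B9Eq311L2Pairing (WL2)
open B9Eq319QprimeTorus (fineP blockCoord)
open B9Eq315QTower (towerP UlevOf)
open B9Eq315QTorus (perCfg cornerSite)
open B7Prop1Explicit (U1 Wcx boxVec)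
open B9Eq316TowerFlatIsOneStep (siteCast towerP_eq_fineP_pow)
open B11Eq103H1Complex (SiteL2K BondL2K covDerivL2K covDivL2K)
open B9Eq310DeltaPrime (reHol imHol)
open B9Eq310HessianOperator (adTransportW curvOp)
open B9Eq326OperatorTower (laplaceAk RofUk G1k H1k QkW QprimeTowerW)
open B9Eq324DeltaPrimeATower (laplacePrimeAk GpOfUk)
open B9Eq3126H1BlockDecayTowerClosed (norm_block_H1k_le_closed)
open B9Eq3126ClosingRadiusWindowTower (radiusT0_pos le_ratios_of_le_radiusT0 eta_windows unit_windows slopes_le small_window small2_window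
  tower_dQ_diff_le_linear)

variable {d : ℕ} (L : ℕ) [NeZero L] (hL2 : 2 ≤ L)
  {𝔸 : Type*} [NormedRing 𝔸] [StarRing 𝔸] [NormedAlgebra ℂ 𝔸] [StarModule ℂ 𝔸] [CompleteSpace 𝔸] [NormOneClass 𝔸]
  {W : Type*} [NormedAddCommGroup W] [InnerProductSpace ℂ W] [FiniteDimensional ℂ W] (φ : W ≃ₗ[ℂ] 𝔸) {Mφ Mφ' : ℝ}
  (hφ : ∀ w, ‖φ w‖ ≤ Mφ * ‖w‖) (hφ' : ∀ X, ‖φ.symm X‖ ≤ Mφ' * ‖X‖) (hMφ : 0 ≤ Mφ) (hMφ' : 0 ≤ Mφ') (hstar : ∀ X : 𝔸, ‖star X‖ ≤ ‖X‖)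
  (τ : 𝔸 →ₗ[ℂ] ℂ) {Mτ : ℝ} (hτ : ∀ X Y : 𝔸, ‖τ (X * Y)‖ ≤ Mτ * ‖X‖ * ‖Y‖) (hMτ : 0 ≤ Mτ)
  (a : ℝ) (ha : 0 ≤ a) {a' : ℝ} (ha' : 0 ≤ a') {ϱ εs : ℝ} (hϱ0 : 0 ≤ ϱ) (hϱ1 : ϱ < 1) (hεs : 0 ≤ εs)
  {γ' κ₁ M : ℝ} (hγ' : 0 < γ') (hγ'1 : γ' ≤ 1) (hκ₁ : 0 < κ₁) (hM : 0 ≤ M)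
  {γ μ₁ pK0 : ℝ} (hγ : 0 < γ) (hγ1 : γ ≤ 1) (hμ₁ : 0 < μ₁) (hpK0 : 0 ≤ pK0) (hgap : pK0 < γ / 2)

set_option maxHeartbeats 1600000 in
include hL2 hφ hφ' hMφ hMφ' hstar hτ hMτ ha ha' hϱ0 hϱ1 hεs hγ' hγ'1 hκ₁ hM hγ hγ1 hμ₁ hpK0 hgap in
/-- **THE `L²` BLOCK DECAY OF `H₁,k(U)` AT EVERY HEIGHT, THE RATE CHOSEN ONCE: `∃ r₀ > 0` (closed form) BEFORE `∀ n η c₀ c₁ m U`.**  (H1TC)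
`norm_block_H1k_le_closed` at `r := r₀`, `r′ := r₀∕2`, `ℓ = ℓ′ = 1`, `β := N_βr₀`, `β′ := N′r₀`, `β_K := 8p_K⁰r₀`, `ρ := (6X + 9X)∕√κ₁`, every radius window by
`B9Eq3126ClosingRadiusWindowTower` (the tower `dQ` window by `tower_dQ_diff_le_linear` on the diagonal `ηL^{n+1} = 1`, `c₀(L^{n+1})^d = c₁`), the curvature letter
bounded by `p_K⁰`.  Displayed: `γ` + `hpos`, `μ₁`, the `G′_k` side, the MODEL letters. [cite: Balaban1985BackgroundPropagators, (3.126) p.420, (3.26) p.395,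
(3.15)–(3.19) p.393, (3.49) p.399, (3.79) p.406, Thm 3.11 p.416; Balaban1985Variational, (45)–(46) p.285, (103) p.293] -/
theorem exists_rate_block_decay_H1k_closed (d : ℕ) :
    ∃ r₀ : ℝ, r₀ = min (1 / 4) (min (1 / (2 * (d : ℝ) + 1)) (min (1 / (4 * (Mφ * Mφ') * (d * Real.sqrt d) + 4 * (Mφ * Mφ') * d + 2 * (Mφ * Mφ') * Real.sqrt d + Mφ' * Mφ * (Real.exp 1 * Real.exp (Real.sqrt ((L : ℝ) ^ d) * (Real.sqrt (2 * d) * (102 * (d + 1) ^ 2 * L)) * (εs / (1 - ϱ))) * (Real.sqrt ((L : ℝ) ^ d) * ((3 * 1 + (2 * d + 1) * 1) * (2 * Real.sqrt (2 * (2 * d * (102 * (d + 1) ^ 2 * L * εs) ^ 2 + 1)))))) + 1)) (min (1 / (Real.sqrt ((L : ℝ) ^ d) * ((3 * 1 + (2 * d + 1) * 1) * (2 * Real.sqrt (2 * (2 * d * (102 * (d + 1) ^ 2 * L * εs) ^ 2 + 1)))))) (min (1 / (2 * (Mφ * Mφ') * Real.sqrt d + 2 * M + 1)) (min (γ' / (12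 * (1 + a') * (2 * (Mφ * Mφ') * Real.sqrt d + 2 * M + 1))) (min (Real.sqrt κ₁ / (120 * ((2 * (Mφ * Mφ') * Real.sqrt d + 2 * M + 1) * (4 / γ' + M * ((4 / γ') ^ 2 * (3 + a' * (2 * M + 1))))))) (min ((γ / 4 - pK0 / 2) / ((21 + 3 * a) * (4 * (Mφ * Mφ') * (d * Real.sqrt d) + 4 * (Mφ * Mφ') * d + 2 * (Mφ * Mφ') * Real.sqrt d + Mφ' * Mφ * (Real.exp 1 * Real.exp (Real.sqrt ((L : ℝ) ^ d) * (Real.sqrt (2 * d) * (102 * (d + 1) ^ 2 * L)) * (εs / (1 - ϱ))) * (Real.sqrt ((L : ℝ) ^ d) * ((3 * 1 + (2 * d + 1) * 1) * (2 * Real.sqrt (2 * (2 * d * (102 * (d + 1) ^ 2 * L * εs) ^ 2 + 1)))))) + 1) + 4 * (4 * (Mφ * Mφ') * (d * Real.sqrt d) + 4 * (Mφ * Mφ') * d + 2 * (Mφ * Mφ') * Real.sqrt d + Mφ' * Mφ * (Real.exp 1 * Real.exp (Real.sqrt ((L : ℝ) ^ d) * (Real.sqrt (2 * d) * (102 * (d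 + 1) ^ 2 * L)) * (εs / (1 - ϱ))) * (Real.sqrt ((L : ℝ) ^ d) * ((3 * 1 + (2 * d + 1) * 1) * (2 * Real.sqrt (2 * (2 * d * (102 * (d + 1) ^ 2 * L * εs) ^ 2 + 1)))))) + 1) * Real.sqrt (M / Real.sqrt κ₁) + 2 * (15 * ((2 * (Mφ * Mφ') * Real.sqrt d + 2 * M + 1) * (4 / γ' + M * ((4 / γ') ^ 2 * (3 + a' * (2 * M + 1))))) / Real.sqrt κ₁) * Real.sqrt (M / Real.sqrt κ₁) ^ 2 + 8 * pK0)) ((μ₁ / 2) / ((4 * (Mφ * Mφ') * (d * Real.sqrt d) + 4 * (Mφ * Mφ') * d + 2 * (Mφ * Mφ') * Real.sqrt d + Mφ' * Mφ * (Real.exp 1 * Real.exp (Real.sqrt ((L : ℝ) ^ d) * (Real.sqrt (2 * d) * (102 * (d + 1) ^ 2 * L)) * (εs / (1 - ϱ))) * (Real.sqrt ((L : ℝ) ^ d) * ((3 * 1 + (2 * d + 1) * 1) * (2 * Real.sqrt (2 * (2 * d * (102 * (d + 1) ^ 2 * L * εs) ^ 2 + 1)))))) + 1) * (4 / γ) *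 (2 * (Mφ' * Mφ * Real.exp (Real.sqrt ((L : ℝ) ^ d) * (Real.sqrt (2 * d) * (102 * (d + 1) ^ 2 * L)) * (εs / (1 - ϱ)))) + 1) + (Mφ' * Mφ * Real.exp (Real.sqrt ((L : ℝ) ^ d) * (Real.sqrt (2 * d) * (102 * (d + 1) ^ 2 * L)) * (εs / (1 - ϱ)))) * ((Mφ' * Mφ * Real.exp (Real.sqrt ((L : ℝ) ^ d) * (Real.sqrt (2 * d) * (102 * (d + 1) ^ 2 * L)) * (εs / (1 - ϱ)))) + 1) * ((4 * (Mφ * Mφ') * (d * Real.sqrt d) + 4 * (Mφ * Mφ') * d + 2 * (Mφ * Mφ') * Real.sqrt d + Mφ' * Mφ * (Real.exp 1 * Real.exp (Real.sqrt ((L : ℝ) ^ d) * (Real.sqrt (2 * d) * (102 * (d + 1) ^ 2 * L)) * (εs / (1 - ϱ))) * (Real.sqrt ((L : ℝ) ^ d) * ((3 * 1 + (2 * d + 1) * 1) * (2 * Real.sqrt (2 * (2 * d * (102 * (d + 1) ^ 2 * L * εs) ^ 2 + 1)))))) + 1) * (4 / γ * (2 * (8 / γ) + (8 / γ + 4 /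 γ) + 2 * ((8 / γ + 4 / γ * Real.sqrt (M / Real.sqrt κ₁)) + 4 / γ) + a * (Mφ' * Mφ * Real.exp (Real.sqrt ((L : ℝ) ^ d) * (Real.sqrt (2 * d) * (102 * (d + 1) ^ 2 * L)) * (εs / (1 - ϱ)))) * (4 / γ) + a * ((Mφ' * Mφ * Real.exp (Real.sqrt ((L : ℝ) ^ d) * (Real.sqrt (2 * d) * (102 * (d + 1) ^ 2 * L)) * (εs / (1 - ϱ)))) + 1) * (4 / γ))) + (15 * ((2 * (Mφ * Mφ') * Real.sqrt d + 2 * M + 1) * (4 / γ' + M * ((4 / γ') ^ 2 * (3 + a' * (2 * M + 1))))) / Real.sqrt κ₁) * ((8 / γ + 4 / γ * Real.sqrt (M / Real.sqrt κ₁)) * ((8 / γ + 4 / γ * Real.sqrt (M / Real.sqrt κ₁)) + 4 / γ)) + 8 * pK0 * (4 / γ) ^ 2)))))))))) ∧ 0 < r₀ ∧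
      ∀ (n : ℕ) (η : ℝ) (_hη : 0 < η) (_hηL : η * (L : ℝ) ^ (n + 1) = 1) (c₀ c₁ : ℝ) [Fact (0 < c₀)] [Fact (0 < c₁)]
        (_hdiag : c₀ * ((L : ℝ) ^ (n + 1)) ^ d = c₁) (m : Fin d → ℕ) [∀ i, NeZero (m i)] (_hm : ∀ i, 1 ≤ m i)
        (U : Bond d (towerP L m (n + 1)) → 𝔸ˣ) (_hU : ∀ b, U b ∈ U1 𝔸)
        (_hRS : ∀ (b : Bond d (towerP L m (n + 1))) (v u : W), ⟪adTransportW φ U b v, u⟫_ℂ = ⟪v, adTransportW φ (fun b => (U b)⁻¹) b u⟫_ℂ)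
        (α : ℕ → ℝ) (_hα0 : ∀ j, 0 ≤ α j) (hα1 : ∀ j, α j ≤ 1 / 64) (hαL : ∀ j, 50 * (d + 1) * α j * (L : ℝ) ^ d ≤ 1 / 2)
        (hU1 : ∀ (j : ℕ) (x : B7Prop1Explicit.Site d) (k : Fin d), perCfg (towerP L m (j + 1)) (UlevOf L m (n + 1) U j) x k ∈ U1 𝔸)
        (hreg : ∀ (j : ℕ) (y : TSite d (towerP L m j)) (k : Fin d) (ρ' : Fin d → Fin L),
          ‖((Wcx L (perCfg (towerP L m (j + 1)) (UlevOf L m (n + 1) U j)) (cornerSite L y) k (boxVec L ρ') : 𝔸ˣ) : 𝔸) - 1‖ ≤ α j)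
        (εU : ℕ → ℝ) (_hεU : ∀ j, 0 ≤ εU j) (_hUε : ∀ (j : ℕ) (b : Bond d (towerP L m (j + 1))), ‖(UlevOf L m (n + 1) U j b : 𝔸) - 1‖ ≤ εU j)
        (_hεg : ∀ j < n + 1, εU j ≤ εs * ϱ ^ j)
        (δ : ℝ) (_hδ : 0 ≤ δ) (_hRe : ∀ p : B9SectCLatticeCarrier.Plaq d (towerP L m (n + 1)), ‖reHol U p - 1‖ ≤ δ)
        (_hIm : ∀ p : B9SectCLatticeCarrier.Plaq d (towerP L m (n + 1)), ‖imHol U p‖ ≤ δ)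
        (_hpK : (768 * Fintype.card (DirPair d) * Mτ * Mφ ^ 2 * (‖((η : ℂ)) ^ d‖ / c₀) * ‖((η : ℂ))⁻¹‖ ^ 2 * δ) ≤ pK0)
        (hpos' : ∀ x : SiteL2K ℂ d (towerP L m (n + 1)) c₀ W, x ≠ 0 → 0 < RCLike.re ⟪x, laplacePrimeAk L m n φ η U a' (c₁ := c₁) x⟫_ℂ)
        (_coercive : ∀ f : SiteL2K ℂ d (towerP L m (n + 1)) c₀ W, γ' * ‖f‖ ^ 2 ≤ ‖(covDerivL2K ℂ c₀ ((η : ℂ))⁻¹ (adTransportW φ U)) f‖ ^ 2 +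
          a' * ‖((WL2.linearEquiv ℂ ℂ (fun _ : TSite d m => c₁)).symm.toLinearMap ∘ₗ QprimeTowerW L m n φ U (c₀ := c₀)) f‖ ^ 2)
        (_hκ : ∀ ψ : SiteL2K ℂ d m c₁ W, κ₁ * ‖ψ‖ ^ 2 ≤ RCLike.re ⟪ψ,
          (((WL2.linearEquiv ℂ ℂ (fun _ : TSite d m => c₁)).symm.toLinearMap ∘ₗ QprimeTowerW L m n φ U (c₀ := c₀)) ∘ₗ
            GpOfUk L m n φ η U a' (c₁ := c₁) hpos' ∘ₗ GpOfUk L m n φ η U a' (c₁ := c₁) hpos' ∘ₗ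
            LinearMap.adjoint ((WL2.linearEquiv ℂ ℂ (fun _ : TSite d m => c₁)).symm.toLinearMap ∘ₗ QprimeTowerW L m n φ U (c₀ := c₀))) ψ⟫_ℂ)
        (_hMQ : ∀ s : SiteL2K ℂ d (towerP L m (n + 1)) c₀ W,
          ‖((WL2.linearEquiv ℂ ℂ (fun _ : TSite d m => c₁)).symm.toLinearMap ∘ₗ QprimeTowerW L m n φ U (c₀ := c₀)) s‖ ≤ M * ‖s‖)
        (hpos : ∀ x : BondL2K ℂ d (towerP L m (n + 1)) c₀ W, x ≠ 0 →
          0 < RCLike.re ⟪x, laplaceAk L m n φ η U (le_trans one_le_two hL2) α hα1 hU1 hreg τ (c₀ := c₀) (c₁ := c₁) a x⟫_ℂ)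
        (_hcoer : ∀ f : BondL2K ℂ d (towerP L m (n + 1)) c₀ W, γ * ‖f‖ ^ 2 ≤
          RCLike.re ⟪f, laplaceAk L m n φ η U (le_trans one_le_two hL2) α hα1 hU1 hreg τ (c₀ := c₀) (c₁ := c₁) a f⟫_ℂ)
        (_hX1 : ∀ g : BondL2K ℂ d m c₁ W, μ₁ * ‖g‖ ^ 2 ≤
          RCLike.re ⟪g, (QkW L m n φ U (le_trans one_le_two hL2) α hα1 hU1 hreg (c₀ := c₀) (c₁ := c₁))
            (G1k L m n φ η U (le_trans one_le_two hL2) α hα1 hU1 hreg τ (c₀ := c₀) (c₁ := c₁) hpos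
              (LinearMap.adjoint (QkW L m n φ U (le_trans one_le_two hL2) α hα1 hU1 hreg (c₀ := c₀) (c₁ := c₁)) g))⟫_ℂ)
        (PB : TSite d m → BondL2K ℂ d (towerP L m (n + 1)) c₀ W →L[ℂ] BondL2K ℂ d (towerP L m (n + 1)) c₀ W)
        (_hPB : ∀ (y : TSite d m) (f : BondL2K ℂ d (towerP L m (n + 1)) c₀ W) (b : Bond d (towerP L m (n + 1))),
          WL2.equiv ℂ (fun _ : Bond d (towerP L m (n + 1)) => c₀) W (PB y f) b =
            if blockCoord (L ^ (n + 1)) m (siteCast (towerP_eq_fineP_pow L m (n + 1)) (bpos b)) = y then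
              WL2.equiv ℂ (fun _ : Bond d (towerP L m (n + 1)) => c₀) W f b else 0)
        (rF : TSite d m → BondL2K ℂ d m c₁ W →L[ℂ] BondL2K ℂ d m c₁ W)
        (_hrF : ∀ (y : TSite d m) (g : BondL2K ℂ d m c₁ W) (b' : Bond d m),
          WL2.equiv ℂ (fun _ : Bond d m => c₁) W (rF y g) b' = if bpos b' = y then WL2.equiv ℂ (fun _ : Bond d m => c₁) W g b' else 0)
        (y₀ y₁ : TSite d m),
        ‖PB y₁ ∘L LinearMap.toContinuousLinearMap (H1k L m n φ η U (le_trans one_le_two hL2) α hα1 hU1 hreg τ (c₀ := c₀) (c₁ := c₁) hαL hpos) ∘L rF y₀‖ ≤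
          (4 / γ * Real.exp r₀) * ((Mφ' * Mφ * Real.exp (Real.sqrt ((L : ℝ) ^ d) * (Real.sqrt (2 * d) * (102 * (d + 1) ^ 2 * L)) * (εs / (1 - ϱ)))) * Real.exp r₀) * (2 / μ₁ * Real.exp r₀) * latticeConst d (r₀ / 2) ^ 2 *
            Real.exp (-(r₀ / 2 * tdist m y₀ y₁)) := by
  have hL1 : 1 ≤ L := le_trans one_le_two hL2
  refine ⟨_, rfl, radiusT0_pos (d := d) (εs := εs) (ϱ := ϱ) hL1 hMφ hMφ' ha ha' hγ' hκ₁ hM hγ hμ₁ hpK0 hgap, ?_⟩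
  intro n η hη hηL c₀ c₁ _ _ hdiag m _ hm U hU hRS α hα0 hα1 hαL hU1 hreg εU hεU hUε hεg δ hδ hRe hIm hpK hpos' coercive hκ hMQ hpos hcoer hX1 PB hPB rF hrF
    y₀ y₁
  -- the radius and its nine ratio bounds
  set r₀ : ℝ := min (1 / 4) (min (1 / (2 * (d : ℝ) + 1)) (min (1 / (4 * (Mφ * Mφ') * (d * Real.sqrt d) + 4 * (Mφ * Mφ') * d + 2 * (Mφ * Mφ') * Real.sqrt d + Mφ' * Mφ * (Real.exp 1 * Real.exp (Real.sqrt ((L : ℝ) ^ d) * (Real.sqrt (2 * d) * (102 * (d + 1) ^ 2 * L)) * (εs / (1 - ϱ))) * (Real.sqrt ((L : ℝ) ^ d) * ((3 * 1 + (2 * d + 1) * 1) * (2 * Real.sqrt (2 * (2 * d * (102 * (d + 1) ^ 2 * L * εs) ^ 2 + 1)))))) + 1)) (min (1 / (Real.sqrt ((L : ℝ) ^ d) * ((3 * 1 + (2 * d + 1) * 1) * (2 * Real.sqrt (2 * (2 * d * (102 * (d + 1) ^ 2 * L * εs) ^ 2 + 1)))))) (min (1 / (2 * (Mφ * Mφ')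 * Real.sqrt d + 2 * M + 1)) (min (γ' / (12 * (1 + a') * (2 * (Mφ * Mφ') * Real.sqrt d + 2 * M + 1))) (min (Real.sqrt κ₁ / (120 * ((2 * (Mφ * Mφ') * Real.sqrt d + 2 * M + 1) * (4 / γ' + M * ((4 / γ') ^ 2 * (3 + a' * (2 * M + 1))))))) (min ((γ / 4 - pK0 / 2) / ((21 + 3 * a) * (4 * (Mφ * Mφ') * (d * Real.sqrt d) + 4 * (Mφ * Mφ') * d + 2 * (Mφ * Mφ') * Real.sqrt d + Mφ' * Mφ * (Real.exp 1 * Real.exp (Real.sqrt ((L : ℝ) ^ d) * (Real.sqrt (2 * d) * (102 * (d + 1) ^ 2 * L)) * (εs / (1 - ϱ))) * (Real.sqrt ((L : ℝ) ^ d) * ((3 * 1 + (2 * d + 1) * 1) * (2 * Real.sqrt (2 * (2 * d * (102 * (d + 1) ^ 2 * L * εs) ^ 2 + 1)))))) + 1) + 4 * (4 * (Mφ * Mφ') * (d * Real.sqrt d) + 4 * (Mφ * Mφ') * d + 2 * (Mφ * Mφ') * Real.sqrt d + Mφ' * Mφ * (Real.exp 1 * Real.exp (Real.sqrt ((L : ℝ)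 ^ d) * (Real.sqrt (2 * d) * (102 * (d + 1) ^ 2 * L)) * (εs / (1 - ϱ))) * (Real.sqrt ((L : ℝ) ^ d) * ((3 * 1 + (2 * d + 1) * 1) * (2 * Real.sqrt (2 * (2 * d * (102 * (d + 1) ^ 2 * L * εs) ^ 2 + 1)))))) + 1) * Real.sqrt (M / Real.sqrt κ₁) + 2 * (15 * ((2 * (Mφ * Mφ') * Real.sqrt d + 2 * M + 1) * (4 / γ' + M * ((4 / γ') ^ 2 * (3 + a' * (2 * M + 1))))) / Real.sqrt κ₁) * Real.sqrt (M / Real.sqrt κ₁) ^ 2 + 8 * pK0)) ((μ₁ / 2) / ((4 * (Mφ * Mφ') * (d * Real.sqrt d) + 4 * (Mφ * Mφ') * d + 2 * (Mφ * Mφ') * Real.sqrt d + Mφ' * Mφ * (Real.exp 1 * Real.exp (Real.sqrt ((L : ℝ) ^ d) * (Real.sqrt (2 * d) * (102 * (d + 1) ^ 2 * L)) * (εs / (1 - ϱ))) * (Real.sqrt ((L : ℝ) ^ d) * ((3 * 1 + (2 * d + 1) * 1) * (2 * Real.sqrt (2 * (2 * d * (102 * (d + 1) ^ 2 * L * εs)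 ^ 2 + 1)))))) + 1) * (4 / γ) * (2 * (Mφ' * Mφ * Real.exp (Real.sqrt ((L : ℝ) ^ d) * (Real.sqrt (2 * d) * (102 * (d + 1) ^ 2 * L)) * (εs / (1 - ϱ)))) + 1) + (Mφ' * Mφ * Real.exp (Real.sqrt ((L : ℝ) ^ d) * (Real.sqrt (2 * d) * (102 * (d + 1) ^ 2 * L)) * (εs / (1 - ϱ)))) * ((Mφ' * Mφ * Real.exp (Real.sqrt ((L : ℝ) ^ d) * (Real.sqrt (2 * d) * (102 * (d + 1) ^ 2 * L)) * (εs / (1 - ϱ)))) + 1) * ((4 * (Mφ * Mφ') * (d * Real.sqrt d) + 4 * (Mφ * Mφ') * d + 2 * (Mφ * Mφ') * Real.sqrt d + Mφ' * Mφ * (Real.exp 1 * Real.exp (Real.sqrt ((L : ℝ) ^ d) * (Real.sqrt (2 * d) * (102 * (d + 1) ^ 2 * L)) * (εs / (1 - ϱ))) * (Real.sqrt ((L : ℝ) ^ d) * ((3 * 1 + (2 * d + 1) * 1) * (2 * Real.sqrt (2 * (2 * d * (102 * (d + 1) ^ 2 * L * εs) ^ 2 + 1)))))) + 1) * (4 /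 γ * (2 * (8 / γ) + (8 / γ + 4 / γ) + 2 * ((8 / γ + 4 / γ * Real.sqrt (M / Real.sqrt κ₁)) + 4 / γ) + a * (Mφ' * Mφ * Real.exp (Real.sqrt ((L : ℝ) ^ d) * (Real.sqrt (2 * d) * (102 * (d + 1) ^ 2 * L)) * (εs / (1 - ϱ)))) * (4 / γ) + a * ((Mφ' * Mφ * Real.exp (Real.sqrt ((L : ℝ) ^ d) * (Real.sqrt (2 * d) * (102 * (d + 1) ^ 2 * L)) * (εs / (1 - ϱ)))) + 1) * (4 / γ))) + (15 * ((2 * (Mφ * Mφ') * Real.sqrt d + 2 * M + 1) * (4 / γ' + M * ((4 / γ') ^ 2 * (3 + a' * (2 * M + 1))))) / Real.sqrt κ₁) * ((8 / γ + 4 / γ * Real.sqrt (M / Real.sqrt κ₁)) * ((8 / γ + 4 / γ * Real.sqrt (M / Real.sqrt κ₁)) + 4 / γ)) + 8 * pK0 * (4 / γ) ^ 2)))))))))) with hr₀def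
  have hr₀pos : 0 < r₀ := radiusT0_pos (d := d) (εs := εs) (ϱ := ϱ) hL1 hMφ hMφ' ha ha' hγ' hκ₁ hM hγ hμ₁ hpK0 hgap
  have hr0 : 0 ≤ r₀ := hr₀pos.le
  obtain ⟨h1, h2, h3, h4, h5, h6, h7, h8, h9⟩ := le_ratios_of_le_radiusT0 (le_refl r₀)
  -- the windows
  obtain ⟨hwin, hwin0, hwin1, hwin'⟩ := eta_windows (d := d) hL1 n hη hηL hr0 h1 h2
  obtain ⟨hβ0, hβ1, hβ'0, hβ'1, small', hwinκ, hρ0, hρ8, hwinT⟩ := unit_windows hL1 hMφ hMφ' ha' hγ' hκ₁ hM hr0 h3 h4 h5 h6 h7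
  obtain ⟨hβCC, hβC, hβD, hβTs, hβ'D, hβ'Q, hβK0⟩ := slopes_le (d := d) (L := L) (εs := εs) (ϱ := ϱ) hMφ hMφ' hM hpK0 hr0
  have hsmall := small_window hL1 hMφ hMφ' ha ha' hγ' hκ₁ hM hpK0 hr0 h3 h8
  have hsmall2 := small2_window hL1 hMφ hMφ' ha ha' hγ' hκ₁ hM hγ hpK0 h9
  -- the diagonal weight ratio is `1`
  have hc₀ : 0 < c₀ := Fact.out
  have hW1 : Real.sqrt (c₁ / (c₀ * ((L : ℝ) ^ (n + 1)) ^ d)) = 1 := by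
    rw [← hdiag, div_self (by positivity), Real.sqrt_one]
  -- `η ≤ 1` and the curvature letter
  have hL1r : (1 : ℝ) ≤ (L : ℝ) ^ (n + 1) := one_le_pow₀ (by exact_mod_cast hL1)
  have hη1 : η ≤ 1 := by
    have hηeq : η = ((L : ℝ) ^ (n + 1))⁻¹ := eq_inv_of_mul_eq_one_left hηL
    rw [hηeq]; exact inv_le_one_of_one_le₀ hL1r
  have hpKnn : 0 ≤ (768 * Fintype.card (DirPair d) * Mτ * Mφ ^ 2 * (‖((η : ℂ)) ^ d‖ / c₀) * ‖((η : ℂ))⁻¹‖ ^ 2 * δ) := by positivity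
  have hβK : 8 * (r₀ * (1 * η)) * (768 * Fintype.card (DirPair d) * Mτ * Mφ ^ 2 * (‖((η : ℂ)) ^ d‖ / c₀) * ‖((η : ℂ))⁻¹‖ ^ 2 * δ) ≤ 8 * pK0 * r₀ := by
    have h1' : r₀ * (1 * η) ≤ r₀ := by rw [one_mul]; exact mul_le_of_le_one_right hr0 hη1
    calc 8 * (r₀ * (1 * η)) * (768 * Fintype.card (DirPair d) * Mτ * Mφ ^ 2 * (‖((η : ℂ)) ^ d‖ / c₀) * ‖((η : ℂ))⁻¹‖ ^ 2 * δ) ≤ 8 * r₀ * pK0 := by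
          apply mul_le_mul (by linarith) hpK hpKnn (by positivity)
      _ = 8 * pK0 * r₀ := by ring
  -- the tower `dQ` window, linearised
  have hdiff := tower_dQ_diff_le_linear (d := d) hL2 n hηL εU hεU hϱ0 hϱ1 hεs hεg hr0 zero_le_one zero_le_one hwinT
  have hβT : Mφ' * Mφ * Real.sqrt (c₁ / (c₀ * ((L : ℝ) ^ (n + 1)) ^ d)) *
      ((∏ j ∈ Finset.range (n + 1), (1 + Real.sqrt ((L : ℝ) ^ d) * (Real.sqrt (2 * d) * (102 * (d + 1) ^ 2 * L * εU j) +
          2 * (r₀ * (if j = 0 then 3 * 1 + (L : ℝ) ^ (n + 1) * (1 * η) else 2 * d * (L : ℝ) ^ (n + 1 - j) * (1 * η))) *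
            Real.sqrt (2 * (2 * d * (102 * (d + 1) ^ 2 * L * εU j) ^ 2 + ((L : ℝ) ^ d)⁻¹))))) -
        ∏ j ∈ Finset.range (n + 1), (1 + Real.sqrt ((L : ℝ) ^ d) * (Real.sqrt (2 * d) * (102 * (d + 1) ^ 2 * L * εU j)))) ≤ (4 * (Mφ * Mφ') * (d * Real.sqrt d) + 4 * (Mφ * Mφ') * d + 2 * (Mφ * Mφ') * Real.sqrt d + Mφ' * Mφ * (Real.exp 1 * Real.exp (Real.sqrt ((L : ℝ) ^ d) * (Real.sqrt (2 * d) * (102 * (d + 1) ^ 2 * L)) * (εs / (1 - ϱ))) * (Real.sqrt ((L : ℝ) ^ d) * ((3 * 1 + (2 * d + 1) * 1) * (2 * Real.sqrt (2 * (2 * d * (102 * (d + 1) ^ 2 * L * εs) ^ 2 + 1)))))) + 1) * r₀ := by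
    have hMM1 : Mφ' * Mφ * Real.sqrt (c₁ / (c₀ * ((L : ℝ) ^ (n + 1)) ^ d)) = Mφ' * Mφ := by rw [hW1, mul_one]
    rw [hMM1]
    have hMM : 0 ≤ Mφ' * Mφ := mul_nonneg hMφ' hMφ
    have hlin : (∏ j ∈ Finset.range (n + 1), (1 + Real.sqrt ((L : ℝ) ^ d) * (Real.sqrt (2 * d) * (102 * (d + 1) ^ 2 * L * εU j) +
          2 * (r₀ * (if j = 0 then 3 * 1 + (L : ℝ) ^ (n + 1) * (1 * η) else 2 * d * (L : ℝ) ^ (n + 1 - j) * (1 * η))) *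
            Real.sqrt (2 * (2 * d * (102 * (d + 1) ^ 2 * L * εU j) ^ 2 + ((L : ℝ) ^ d)⁻¹))))) -
        ∏ j ∈ Finset.range (n + 1), (1 + Real.sqrt ((L : ℝ) ^ d) * (Real.sqrt (2 * d) * (102 * (d + 1) ^ 2 * L * εU j))) ≤ (Real.exp 1 * Real.exp (Real.sqrt ((L : ℝ) ^ d) * (Real.sqrt (2 * d) * (102 * (d + 1) ^ 2 * L)) * (εs / (1 - ϱ))) * (Real.sqrt ((L : ℝ) ^ d) * ((3 * 1 + (2 * d + 1) * 1) * (2 * Real.sqrt (2 * (2 * d * (102 * (d + 1) ^ 2 * L * εs) ^ 2 + 1)))))) * r₀ := by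
      refine hdiff.trans (le_of_eq ?_); ring
    exact (mul_le_mul_of_nonneg_left hlin hMM).trans hβTs
  -- `small` with the curvature letter bounded by `p_K⁰`
  have small : (768 * Fintype.card (DirPair d) * Mτ * Mφ ^ 2 * (‖((η : ℂ)) ^ d‖ / c₀) * ‖((η : ℂ))⁻¹‖ ^ 2 * δ) / 2 + (21 + 3 * a) * ((4 * (Mφ * Mφ') * (d * Real.sqrt d) + 4 * (Mφ * Mφ') * d + 2 * (Mφ * Mφ') * Real.sqrt d + Mφ' * Mφ * (Real.exp 1 * Real.exp (Real.sqrt ((L : ℝ) ^ d) * (Real.sqrt (2 * d) * (102 * (d + 1) ^ 2 * L)) * (εs / (1 - ϱ))) * (Real.sqrt ((L : ℝ) ^ d) * ((3 * 1 + (2 * d + 1) * 1) * (2 * Real.sqrt (2 * (2 * d * (102 * (d + 1) ^ 2 * L * εs) ^ 2 + 1)))))) + 1) * r₀) ^ 2 + 4 * ((4 * (Mφ * Mφ') * (d * Real.sqrt d) + 4 * (Mφ * Mφ') * d + 2 * (Mφ * Mφ') * Real.sqrt d + Mφ' * Mφ * (Real.exp 1 * Real.exp (Real.sqrt ((L : ℝ)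 ^ d) * (Real.sqrt (2 * d) * (102 * (d + 1) ^ 2 * L)) * (εs / (1 - ϱ))) * (Real.sqrt ((L : ℝ) ^ d) * ((3 * 1 + (2 * d + 1) * 1) * (2 * Real.sqrt (2 * (2 * d * (102 * (d + 1) ^ 2 * L * εs) ^ 2 + 1)))))) + 1) * r₀) * Real.sqrt (M / Real.sqrt κ₁) +
      2 * ((6 * ((2 * (Mφ * Mφ') * Real.sqrt d + 2 * M + 1) * r₀ * (4 / γ' + M * ((4 / γ') ^ 2 * (3 + a' * (2 * M + 1))))) + 9 * ((2 * (Mφ * Mφ') * Real.sqrt d + 2 * M + 1) * r₀ * (4 / γ' + M * ((4 / γ') ^ 2 * (3 + a' * (2 * M + 1)))))) / Real.sqrt κ₁) * (Real.sqrt (M / Real.sqrt κ₁)) ^ 2 + 8 * pK0 * r₀ ≤ γ / 4 := by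
    have : (768 * Fintype.card (DirPair d) * Mτ * Mφ ^ 2 * (‖((η : ℂ)) ^ d‖ / c₀) * ‖((η : ℂ))⁻¹‖ ^ 2 * δ) / 2 ≤ pK0 / 2 := by linarith
    linarith [hsmall]
  -- `small2` at the diagonal `C_Q`
  have small2 : (4 * (Mφ * Mφ') * (d * Real.sqrt d) + 4 * (Mφ * Mφ') * d + 2 * (Mφ * Mφ') * Real.sqrt d + Mφ' * Mφ * (Real.exp 1 * Real.exp (Real.sqrt ((L : ℝ) ^ d) * (Real.sqrt (2 * d) * (102 * (d + 1) ^ 2 * L)) * (εs / (1 - ϱ))) * (Real.sqrt ((L : ℝ) ^ d) * ((3 * 1 + (2 * d + 1) * 1) * (2 * Real.sqrt (2 * (2 * d * (102 * (d + 1) ^ 2 * L * εs) ^ 2 + 1)))))) + 1) * r₀ * (4 / γ) * (2 * (Mφ' * Mφ * Real.sqrt (c₁ / (c₀ * ((L : ℝ) ^ (n + 1)) ^ d)) *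
        Real.exp (Real.sqrt ((L : ℝ) ^ d) * (Real.sqrt (2 * d) * (102 * (d + 1) ^ 2 * L)) * (εs / (1 - ϱ)))) + 1) +
      (Mφ' * Mφ * Real.sqrt (c₁ / (c₀ * ((L : ℝ) ^ (n + 1)) ^ d)) * Real.exp (Real.sqrt ((L : ℝ) ^ d) * (Real.sqrt (2 * d) * (102 * (d + 1) ^ 2 * L)) * (εs / (1 - ϱ)))) *
        ((Mφ' * Mφ * Real.sqrt (c₁ / (c₀ * ((L : ℝ) ^ (n + 1)) ^ d)) * Real.exp (Real.sqrt ((L : ℝ) ^ d) * (Real.sqrt (2 * d) * (102 * (d + 1) ^ 2 * L)) * (εs / (1 - ϱ)))) + 1) *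
        ((4 * (Mφ * Mφ') * (d * Real.sqrt d) + 4 * (Mφ * Mφ') * d + 2 * (Mφ * Mφ') * Real.sqrt d + Mφ' * Mφ * (Real.exp 1 * Real.exp (Real.sqrt ((L : ℝ) ^ d) * (Real.sqrt (2 * d) * (102 * (d + 1) ^ 2 * L)) * (εs / (1 - ϱ))) * (Real.sqrt ((L : ℝ) ^ d) * ((3 * 1 + (2 * d + 1) * 1) * (2 * Real.sqrt (2 * (2 * d * (102 * (d + 1) ^ 2 * L * εs) ^ 2 + 1)))))) + 1) * r₀ * (4 / γ * (2 * (8 / γ) + (8 / γ + 4 / γ) + 2 * ((8 / γ + 4 / γ * Real.sqrt (M / Real.sqrt κ₁)) + 4 / γ) +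
          a * (Mφ' * Mφ * Real.sqrt (c₁ / (c₀ * ((L : ℝ) ^ (n + 1)) ^ d)) * Real.exp (Real.sqrt ((L : ℝ) ^ d) * (Real.sqrt (2 * d) * (102 * (d + 1) ^ 2 * L)) * (εs / (1 - ϱ)))) * (4 / γ) +
          a * ((Mφ' * Mφ * Real.sqrt (c₁ / (c₀ * ((L : ℝ) ^ (n + 1)) ^ d)) * Real.exp (Real.sqrt ((L : ℝ) ^ d) * (Real.sqrt (2 * d) * (102 * (d + 1) ^ 2 * L)) * (εs / (1 - ϱ)))) + 1) * (4 / γ))) +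
          ((6 * ((2 * (Mφ * Mφ') * Real.sqrt d + 2 * M + 1) * r₀ * (4 / γ' + M * ((4 / γ') ^ 2 * (3 + a' * (2 * M + 1))))) + 9 * ((2 * (Mφ * Mφ') * Real.sqrt d + 2 * M + 1) * r₀ * (4 / γ' + M * ((4 / γ') ^ 2 * (3 + a' * (2 * M + 1)))))) / Real.sqrt κ₁) * ((8 / γ + 4 / γ * Real.sqrt (M / Real.sqrt κ₁)) * ((8 / γ + 4 / γ * Real.sqrt (M / Real.sqrt κ₁)) + 4 / γ)) + 8 * pK0 * r₀ * (4 / γ) ^ 2) ≤ μ₁ / 2 := by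
    have hCQ : Mφ' * Mφ * Real.sqrt (c₁ / (c₀ * ((L : ℝ) ^ (n + 1)) ^ d)) * Real.exp (Real.sqrt ((L : ℝ) ^ d) * (Real.sqrt (2 * d) * (102 * (d + 1) ^ 2 * L)) * (εs / (1 - ϱ))) =
        Mφ' * Mφ * Real.exp (Real.sqrt ((L : ℝ) ^ d) * (Real.sqrt (2 * d) * (102 * (d + 1) ^ 2 * L)) * (εs / (1 - ϱ))) := by rw [hW1, mul_one]
    rw [hCQ]
    exact hsmall2
  have hr' : 0 ≤ r₀ / 2 := by positivity
  have hr'r : r₀ / 2 < r₀ := by linarith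
  have h := norm_block_H1k_le_closed L m n φ hφ hφ' hMφ hMφ' hstar hη hηL U hU hRS τ hτ hMτ hL1 hm α hα0 hα1 hαL hU1 hreg εU hεU hUε hϱ0 hϱ1 hεs hεg
    hδ hRe hIm ha' hpos' hγ' hγ'1 hκ₁ hM coercive hκ hMQ (r := r₀) (ℓ := 1) (ℓ' := 1) (β := (4 * (Mφ * Mφ') * (d * Real.sqrt d) + 4 * (Mφ * Mφ') * d + 2 * (Mφ * Mφ') * Real.sqrt d + Mφ' * Mφ * (Real.exp 1 * Real.exp (Real.sqrt ((L : ℝ) ^ d) * (Real.sqrt (2 * d) * (102 * (d + 1) ^ 2 * L)) * (εs / (1 - ϱ))) * (Real.sqrt ((L : ℝ) ^ d) * ((3 * 1 + (2 * d + 1) * 1) * (2 * Real.sqrt (2 * (2 * d * (102 * (d + 1) ^ 2 * L * εs) ^ 2 + 1)))))) + 1) * r₀) (βK := 8 * pK0 * r₀) (β' := (2 * (Mφ * Mφ') * Real.sqrt d + 2 * M + 1) * r₀)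
    (ρ := ((6 * ((2 * (Mφ * Mφ') * Real.sqrt d + 2 * M + 1) * r₀ * (4 / γ' + M * ((4 / γ') ^ 2 * (3 + a' * (2 * M + 1))))) + 9 * ((2 * (Mφ * Mφ') * Real.sqrt d + 2 * M + 1) * r₀ * (4 / γ' + M * ((4 / γ') ^ 2 * (3 + a' * (2 * M + 1)))))) / Real.sqrt κ₁)) hr0 le_rfl le_rfl hβ'0 hβ'1 hwin hwin0 hwin1 hwin' hβT hβK hβ'D hβ'Q small' hwinκ le_rfl a ha hpos hγ hγ1 hβ0 hβ1 hβK0 hρ0 hρ8 hμ₁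
    hcoer hX1 hβCC hβC hβD small small2 PB hPB hrF hr' hr'r y₀ y₁
  have hsub : r₀ - r₀ / 2 = r₀ / 2 := by ring
  have hCQ' : Mφ' * Mφ * Real.sqrt (c₁ / (c₀ * ((L : ℝ) ^ (n + 1)) ^ d)) * Real.exp (Real.sqrt ((L : ℝ) ^ d) * (Real.sqrt (2 * d) * (102 * (d + 1) ^ 2 * L)) * (εs / (1 - ϱ))) =
      Mφ' * Mφ * Real.exp (Real.sqrt ((L : ℝ) ^ d) * (Real.sqrt (2 * d) * (102 * (d + 1) ^ 2 * L)) * (εs / (1 - ϱ))) := by rw [hW1, mul_one]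
  rw [hCQ', mul_one, hsub] at h
  exact h

end Literature.MathematicalPhysics.QuantumFieldTheory.Balaban1983to89.B9Eq3126H1BlockDecayTowerClosedRadius

end
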